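import Literature.NumberTheory.EllipticCurves.KrizLi2019.EisensteinHeegnerLog
import Summits.BirchSwinnertonDyer.Rank1Residual.X11b.BDPRouteRankOneBookkeeping
import Summits.BirchSwinnertonDyer.Rank1Residual.O5.HeegnerLogTransportThreeKrizLiGlue
import HarnessLib

/-!
# O11 at an additive Eisenstein prime, ROUTE U — T-U2: the Heegner INDEX from the unit `p`-adic
# logarithm (`ord_p [E(K) : ℤP] = ord_p c`), kernel form of Theorem U (iv)

HONEST FRAMING (cell `bsd-cm`, run/shared/lean/pub/bsd-cm/, verbatim): the programme isolates, for
CM elliptic curves over `ℚ` of analytic rank `≤ 1`, classes on which the FULL BSD formula is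
reduced — strictly by PUBLISHED theorems entering as named-fact binders — to ONE local problem at
ONE prime, and then TYPES that residual problem. Seat `bsd-cm-ram` (generation 3; statement typed
by the planner, TARGET.md §2 T-U2, sketch `HOME/lean/X12/O11/RouteUHeegnerIndexTU2.sketch.lean`).
THEOREMS ONLY (no definition, no named fact, nothing asserted about any curve; no label moves).

## What is here (ROUTE U of `HOME/bsd-cm-ram/ROUTE-U.md`, §3 and Thm. U (iv); TARGET §2 T-U0–T-U5)

The kernel chain of THEOREM U is T-U0 (`O11.bsdp_of_heegnerIndexVal_eq_maninVal`, file
`HeegnerIndexManinDescent.lean`: `BSD(E,p)` from `hI : ord_p [E(K):ℤP] = ord_p c` + `p ∤ ∏c_ℓ`,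
`p ∤ #Ш(E)`, `p ∤ #Ш(E^{d_K})`) ∘ T-U2 (this file: `hI` from the UNIT statement
`‖(|Ẽ^{ns}(𝔽_p)|/p) · log_{ω_𝓔} P / c‖_p = 1`) ∘ T-U1 (Kriz–Li 2019 Thm. 1.20, the tree's named fact
`KrizLi2019.thm120_padicLogHeegner_unit_of_bernoulli`: "`≢ 0 (mod p)`") ∘ Rem. 3.10 (named fact
`KrizLi2019.rem310_padicLogHeegner_integral`: `p`-integrality; together "is a `p`-adic unit",
`KrizLi2019.norm_eq_one_of_rem310`).

* (i) `RouteU.padicValNat_index_eq_padicValInt_manin_of_norm_eq_one` — **the class-free,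
  prime-generic core**, PROVED: for `W/ℚ` globally minimal, a prime `p` with `|Ẽ^{ns}(𝔽_p)| = p`
  (additive reduction, Kriz–Li Rem. 1.17), `P ∈ E(K)`, a modular parametrisation `D` of level `N_W`
  with constant `c = D.c` (`ω_𝓔 = c · ω_E`), an embedding `ιp : K → ℚ_p`, `E(K)` of rank one with an
  integral coordinate `crd` (`crd g = 1`, kernel = torsion — the binders of the tree's
  `X11b.RankOne.padicValNat_index_zmultiples_eq`), no `p`-torsion in `E(K)`, and the generator `g`
  of LEVEL ZERO (`‖log_{ω_E} g‖_p = 1`): the unit statement gives `ord_p [E(K) : ℤP] = ord_p c`.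
  Proof (Mordell–Weil bookkeeping, ≈ 50 lines): `KrizLi2019.padicLogOrd_eq_of_norm_eq_one` turns the
  unit statement into `ord_p log_{ω_E} P = ord_p c` (`ord_p |Ẽ^{ns}| = ord_p p = 1`); `log_{ω_E}` is
  the ADDITIVE `ℤ_p`-linear logarithm `padicLog ∘ (P ↦ P_ι)` (O5's
  `padicLogOmega_eq_padicLog`, kernel = torsion `Additive.LocalLog.padicLog_eq_zero_iff`), so
  `P = (crd P)·g + torsion` gives `log_{ω_E} P = (crd P) · log_{ω_E} g`, `ord_p log_{ω_E} P =
  ord_p (crd P)`; and `ord_p [E(K):ℤP] = ord_p |crd P|` is the tree's rank-one bookkeeping.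
* (ii) `RouteU.heegnerIndexVal_eq_maninVal_of_rem310` — (i) at the Heegner point of Thm. 1.16's
  setting, from the named fact `hRem` (Rem. 3.10) and the CONCLUSION `hne` of Thm. 1.20
  (`¬ ‖·‖ ≤ p⁻¹`; the curve-specific Bernoulli / trace-form / character hypotheses of Thm. 1.20 are
  consumed only by the caller instantiating `thm120_…` — T-U5).
* (iii) `RouteU.nsPointCount_eq_of_lFunction_eq_zero` — `|Ẽ^{ns}(𝔽_p)| = p` at a bad prime with
  `a_p = 0` (additive reduction; `KrizLi2019.nsPointCount` unfolds to `p + [good] − a_p`).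

For ROUTE U proper: `p = 7`, `W` = the minimal model of `49a1^{(D)}` (additive at `7`, `7`
Eisenstein via the rational `7`-isogeny), `K = K''` an auxiliary imaginary quadratic field with `7`
and every prime of `D` split, `g` of level `0` ⟺ `n(D) = 0` (memo §2: 103 two-engine instances
`|D| ≤ 3000`). What this file does NOT do: prove Thm. 1.20 / Rem. 3.10 (named facts), the descent
Prop. D of the memo (T-U3: `#Sel⁷ = 7`, the twin's `Ш[7] = 0`, from `7 ∤ β₁β₂`), or the Bernoulli
certificates (T-U3′/T-U4); the composition T-U5 is filed separately once T-U0's module is built.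

References: [KrizLi2019] Thm. 1.20 (pp. 7–8) = Thm. 7.1, Rem. 1.17 (p. 6), Rem. 3.10 (p. 26), §10.3;
[JetchevSkinnerWan2017] Prop. 3.2.1 / (7.1.5) (the index `[E(K):ℤP]_p`); [Castella2018] §2.2
(`log_{ω_E}`); [SilvermanAEC2009] IV.6.4, VII.6.3, VIII.6.
-/

noncomputable section

open scoped Classical
open NumberField WeierstrassCurve IsDedekindDomain Literature.NumberTheory.EllipticCurves
open Literature.NumberTheory.EllipticCurves.ModularForms
open Literature.NumberTheory.EllipticCurves.Rank1Residual (Addv)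

namespace Summit.BirchSwinnertonDyer.Rank1Residual.X12.O11.RouteU

/-- **T-U2 core (prime-generic, class-free): the Heegner index from the unit logarithm.** For
`W/ℚ` globally minimal, `p` a prime with `|Ẽ^{ns}(𝔽_p)| = p` (additive reduction), `P ∈ E(K)`, a
modular parametrisation `D` of level `N_W` with constant `c = D.c` (`ω_𝓔 = c · ω_E`), an embedding
`ιp : K → ℚ_p`; `E(K)` of rank one with integral coordinate `crd` (kernel = torsion, `crd g = 1`),
no `p`-torsion in `E(K)`, and the generator `g` of LEVEL ZERO (`‖log_{ω_E} g_ιp‖_p = 1`): the unit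
statement `‖(|Ẽ^{ns}(𝔽_p)|/p) · log_{ω_E} P / c‖_p = 1` (= Kriz–Li Thm. 1.20 ∧ Rem. 3.10 via
`KrizLi2019.norm_eq_one_of_rem310`) gives **`ord_p [E(K) : ℤP] = ord_p c`** — memo ROUTE-U §3 /
Thm. U (iv) ("`ord₇ log_{ω_𝓔}(P) = ord₇ c` and `n = 0` ⇒ `ord₇[E(K″):ℤP] = ord₇ c`"). PROVED
(`log_{ω_E} = padicLog ∘ (P ↦ P_ι)` is additive and kills torsion; `P = (crd P)·g + t`; valuations;
the tree's `X11b.RankOne.padicValNat_index_zmultiples_eq`).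
[cite: KrizLi2019, Rem. 1.17 (p. 6), Rem. 3.10 (p. 26) and §10.3 (the index from the logarithm)]
[cite: JetchevSkinnerWan2017, Prop. 3.2.1 and (7.1.5) (the index `[E(K):ℤP]_p`)]
[cite: SilvermanAEC2009, IV.6.4 and VII.6.3 (the `ℤ_p`-linear logarithm, kernel = torsion)] -/
theorem padicValNat_index_eq_padicValInt_manin_of_norm_eq_one
    (W : WeierstrassCurve ℚ) [W.IsElliptic] [W.IsGloballyMinimal] (p : ℕ) [Fact p.Prime]
    [NeZero (W.conductorNorm ℤ)] (D : ModularParametrizationData W (W.conductorNorm ℤ))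
    {K : Type} [Field K] [NumberField K] (ιp : K →+* ℚ_[p])
    (P : (W.baseChange K).toAffine.Point)
    (hunit : ‖((KrizLi2019.nsPointCount W p : ℤ) : ℚ_[p]) / (p : ℚ_[p]) *
        (Castella2018.padicLogOmega W p ιp P / (D.maninConstant : ℚ_[p]))‖ = 1)
    (hns : KrizLi2019.nsPointCount W p = p)
    [Finite (AddCommGroup.torsion (W.baseChange K).toAffine.Point)]
    (crd : (W.baseChange K).toAffine.Point →+ ℤ) (g : (W.baseChange K).toAffine.Point)
    (hg : crd g = 1) (hker : ∀ x, crd x = 0 → IsOfFinAddOrder x)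
    (hiv : ∀ x : (W.baseChange K).toAffine.Point, p • x = 0 → x = 0)
    (hg0 : ‖Castella2018.padicLogOmega W p ιp g‖ = 1) :
    padicValNat p (AddSubgroup.zmultiples P).index = padicValInt p D.c := by
  -- (a) the unit statement in `ord_p` bookkeeping: `log_ω P ≠ 0`, `c ≠ 0`,
  --     `ord_p |Ẽ^{ns}| − 1 + ord_p log_ω P − ord_p c = 0`, and `ord_p |Ẽ^{ns}| = ord_p p = 1`
  obtain ⟨hL0, hc0, -, hsum⟩ := KrizLi2019.padicLogOrd_eq_of_norm_eq_one hunit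
  have hns1 : padicValInt p (KrizLi2019.nsPointCount W p) = 1 := by
    rw [hns]; exact padicValInt_self
  have hordL : (Castella2018.padicLogOmega W p ιp P).valuation = (padicValInt p D.c : ℤ) := by
    rw [Castella2018.valuation_padicLogOmega hL0]
    rw [hns1] at hsum
    change ((1 : ℕ) : ℤ) - 1 + padicLogOrd W p ιp P - (padicValInt p D.c : ℤ) = 0 at hsum
    push_cast at hsum
    linarith
  -- (b) `P = (crd P) • g + t`, `t` torsion ⇒ `log_ω P = (crd P) · log_ω g` (`log_ω` is additive and
  --     kills torsion: it is `padicLog ∘ (P ↦ P_ι)`)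
  set φ : (W.baseChange K).toAffine.Point →+ ℚ_[p] :=
    (Additive.LocalLog.padicLog (W.baseChange ℚ_[p])).comp
      (WeierstrassCurve.Affine.Point.map ιp.toRatAlgHom) with hφ
  have hφ' : ∀ Q : (W.baseChange K).toAffine.Point, Castella2018.padicLogOmega W p ιp Q = φ Q :=
    fun Q => by rw [O5.HeegnerLogTransport.padicLogOmega_eq_padicLog]; rfl
  have ht : IsOfFinAddOrder (P - crd P • g) :=
    X11b.RankOne.isOfFinAddOrder_sub_coord_zsmul crd g hg hker P
  have hφt : φ (P - crd P • g) = 0 := by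
    have h1 : IsOfFinAddOrder (WeierstrassCurve.Affine.Point.map ιp.toRatAlgHom (P - crd P • g)) :=
      AddMonoidHom.isOfFinAddOrder _ ht
    rw [hφ, AddMonoidHom.comp_apply, Additive.LocalLog.padicLog_eq_zero_iff]
    exact h1
  have hdec : Castella2018.padicLogOmega W p ιp P =
      ((crd P : ℤ) : ℚ_[p]) * Castella2018.padicLogOmega W p ιp g := by
    rw [hφ' P, hφ' g]
    have hP' : P = crd P • g + (P - crd P • g) := by abel
    conv_lhs => rw [hP']
    rw [map_add, hφt, add_zero, map_zsmul, zsmul_eq_mul]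
  -- (c) `crd P ≠ 0` (else `log_ω P = 0`) and `ord_p log_ω g = 0` (level zero)
  have hP0 : crd P ≠ 0 := by
    intro h0
    apply hL0
    rw [hdec, h0, Int.cast_zero, zero_mul]
  have hLg0 : Castella2018.padicLogOmega W p ιp g ≠ 0 := fun h0 => by
    rw [h0, norm_zero] at hg0; exact zero_ne_one hg0
  have hp_pos : (0 : ℝ) < p := mod_cast (Fact.out : p.Prime).pos
  have hp_ne_one : (p : ℝ) ≠ 1 := mod_cast (Fact.out : p.Prime).ne_one
  have hvLg : (Castella2018.padicLogOmega W p ιp g).valuation = 0 := by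
    have h := Padic.norm_eq_zpow_neg_valuation hLg0
    rw [hg0, eq_comm, ← zpow_zero (p : ℝ), zpow_right_inj₀ hp_pos hp_ne_one, neg_eq_zero] at h
    exact h
  -- (d) `ord_p log_ω P = ord_p (crd P)`, so `ord_p (crd P) = ord_p c`
  have hvL : (Castella2018.padicLogOmega W p ιp P).valuation = (padicValInt p (crd P) : ℤ) := by
    have hc' : ((crd P : ℤ) : ℚ_[p]) ≠ 0 := by exact_mod_cast hP0
    rw [hdec, Padic.valuation_mul hc' hLg0, hvLg, add_zero, Padic.valuation_intCast]
  have hval : padicValInt p (crd P) = padicValInt p D.c := by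
    have h := hvL.symm.trans hordL
    exact_mod_cast h
  -- (e) `ord_p [E(K) : ℤP] = ord_p |crd P|` (rank-one bookkeeping)
  rw [X11b.RankOne.padicValNat_index_zmultiples_eq crd g hg hker hiv P hP0, ← hval]
  rfl

/-- **T-U2 from the two named facts** (Kriz–Li Rem. 3.10 = `hRem :
KrizLi2019.rem310_padicLogHeegner_integral` BY NAME, and the CONCLUSION `hne` of Thm. 1.20 =
`KrizLi2019.thm120_padicLogHeegner_unit_of_bernoulli` instantiated by the caller): at the Heegner
point `P ∈ E(K)` of Thm. 1.16's setting (`K` imaginary quadratic with the Heegner hypothesis for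
`N_W`, `p` split in `K`, `ι(P) = heegnerPointComplex D H`), with `|Ẽ^{ns}(𝔽_p)| = p` and the
rank-one level-zero coordinate data of (i): **`ord_p [E(K) : ℤP] = ord_p c`** = the binder `hI` of
T-U0 `O11.bsdp_of_heegnerIndexVal_eq_maninVal`. The Bernoulli / trace-form / character hypotheses of
Thm. 1.20 (`hss`, `hB`, …) are consumed only through `hne`. PROVED ((i) ∘ `norm_eq_one_of_rem310`).
[cite: KrizLi2019, Thm. 1.20 (pp. 7–8), Rem. 3.10 (p. 26), Rem. 1.21 (p. 8)] -/
theorem heegnerIndexVal_eq_maninVal_of_rem310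
    (hRem : KrizLi2019.rem310_padicLogHeegner_integral)
    (W : WeierstrassCurve ℚ) [W.IsElliptic] [W.IsGloballyMinimal] (p : ℕ) [Fact p.Prime]
    [NeZero (W.conductorNorm ℤ)] (D : ModularParametrizationData W (W.conductorNorm ℤ))
    {K : Type} [Field K] [NumberField K] (hK : IsImaginaryQuadratic K)
    (hH : SatisfiesHeegnerHypothesis (W.conductorNorm ℤ) K)
    (hsplit : ((Ideal.span {(p : ℤ)}).primesOver (𝓞 K)).ncard = 2)
    (H : HeegnerDatum (W.conductorNorm ℤ) (NumberField.discr K)) (ι : K →+* ℂ) (ιp : K →+* ℚ_[p])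
    (P : (W.baseChange K).toAffine.Point)
    (hP : WeierstrassCurve.Affine.Point.map ι.toRatAlgHom P = heegnerPointComplex D H)
    (hne : ¬ ‖((KrizLi2019.nsPointCount W p : ℤ) : ℚ_[p]) / (p : ℚ_[p]) *
        (Castella2018.padicLogOmega W p ιp P / (D.maninConstant : ℚ_[p]))‖ ≤ (p : ℝ)⁻¹)
    (hns : KrizLi2019.nsPointCount W p = p)
    [Finite (AddCommGroup.torsion (W.baseChange K).toAffine.Point)]
    (crd : (W.baseChange K).toAffine.Point →+ ℤ) (g : (W.baseChange K).toAffine.Point)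
    (hg : crd g = 1) (hker : ∀ x, crd x = 0 → IsOfFinAddOrder x)
    (hiv : ∀ x : (W.baseChange K).toAffine.Point, p • x = 0 → x = 0)
    (hg0 : ‖Castella2018.padicLogOmega W p ιp g‖ = 1) :
    padicValNat p (AddSubgroup.zmultiples P).index = padicValInt p D.c :=
  padicValNat_index_eq_padicValInt_manin_of_norm_eq_one W p D ιp P
    (KrizLi2019.norm_eq_one_of_rem310 hRem D hK hH hsplit H ι ιp hP hne) hns crd g hg hker hiv hg0

/-- **`|Ẽ^{ns}(𝔽_p)| = p` at a bad prime with `a_p = 0`** (additive reduction: no `+1`, `a_p = 0`;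
Kriz–Li Rem. 1.17), from the body of `KrizLi2019.nsPointCount` (`p + [good] − a_p`). Callers get `ha`
from the tree's `WeierstrassCurve.LFunction_apply_eq_zero_of_hasAdditiveReductionAt` and `hgood`
from additive ⇒ not good. PROVED. [cite: KrizLi2019, Rem. 1.17 (p. 6) (`|Ẽ^{ns}(𝔽_p)|` at an additive prime)] -/
theorem nsPointCount_eq_of_lFunction_eq_zero
    (W : WeierstrassCurve ℚ) [W.IsGloballyMinimal] (p : ℕ) [hp : Fact p.Prime]
    (hgood : ¬ W.HasGoodReductionAtPrime p) (ha : W.LFunction p = 0) :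
    KrizLi2019.nsPointCount W p = p := by
  unfold KrizLi2019.nsPointCount
  rw [dif_pos hp.out, ha, sub_zero]
  simp [hgood]

end Summit.BirchSwinnertonDyer.Rank1Residual.X12.O11.RouteU
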